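import Summits.Ventures.YMGap.RobustBall.ZNPoincare
import Summits.Ventures.YMGap.RobustBall.CentreTubeWindowMembers
import HarnessLib

/-!
# RobustBall/FluxDefectOfRange — EVERY finite-range member of the carrier has a finite-range flux-local twist defect:
# the tier-1 range-`r` ball around any centre-blind action lies in the windowed centre tube (window `2r+2`, extent `2r+1`),
# given a defect-row bound

HONEST FRAMING: venture file of the cell `pub-ymgap` (track Y2 ROBUST-BALL, seat ds-4 g8); finite combinatorics on the torus
plus the carrier's gauge invariance — steps (P3)–(P5) of HOME/ds/ds4/CENTRE-TUBE.md §5 MODULO the defect-row count (P4), which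
is taken as a hypothesis `hrow`.  WHAT THIS IS: for a perturbation `W` with `HasRange r W` (activities of polymers of diameter `> r`
vanish) on a torus with `2r + 2 < L`, and a load witness `w` (per-link oscillation bounds `osc X e`):
* `fluxDefect W r X φ U` — the twist defect of the activity `W_X` as a function of the FLUX configuration on the box of `X`
  (corner `basePt X − r·𝟙`, side `2r+2`; well defined by the discrete Poincaré lemma `ZNPoincare.apply_twistOf_mul_eq_of_plaqSum_eq`:
  a gauge-invariant activity reading only box links sees a twist only through its box fluxes);
* `total_twist_eq_fluxDefect`: `W(ζ_k U) = W(U) + ∑_X fluxDefect W r X (curl k) U` for EVERY twist `k`;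
* `dependsOn_fluxDefect`, `abs_fluxDefect_le` (`≤ oscSum w X = ∑_{e ∈ links X} osc X e`, Friedli–Velenik (6.39)), window `2r+2`
  and extent `2r+1` of the box supports;
* ★ `isFluxLocalW_of_hasRange`: `IsFluxLocalW (2r+2) (2r+1) b W` whenever the defect rows
  `∑_{X : y ∈ iLinks i (boxSupp r X)} oscSum w X (|iLinks i (boxSupp r X)| − 1) ≤ b`; hence (`areaLaw_of_hasRange_add_twistBlind`)
  the windowed centre-tube bound for `W_b + W` with `W_b` twist-blind of ANY size — the range-`r` tier-1 ball (oscillation loads only, NO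
  Lipschitz load, any `N`-ality) around the whole centre-blind affine subspace, at `2(d−1)N|β| + b ≤ 1`.
WHAT IS LEFT (P4): bounding `b` by the ball's oscillation load `ε₀` times a counting constant `K(d, r)`.  Nothing continuum / Clay.
-/

noncomputable section

open Finset Function
open Literature.MathematicalPhysics.QuantumLattice (fundamentalRep)
open Literature.MathematicalPhysics.QuantumFieldTheory

namespace Summit.Ventures.YMGap.RobustBall

open ZN ZNFluxW

variable {d L N : ℕ} [NeZero L] [NeZero N]

/-! ### The box of a polymer -/

/-- A base point of `X` (`0` for the empty polymer). [folklore] -/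
def basePt (X : Finset (Site d L)) : Site d L := if h : X.Nonempty then Classical.choose h else 0

omit [NeZero L] [NeZero N] in
/-- The base point of a nonempty polymer belongs to it. [folklore] -/
theorem basePt_mem {X : Finset (Site d L)} (h : X.Nonempty) : basePt X ∈ X := by
  rw [basePt, dif_pos h]; exact Classical.choose_spec h

/-- The corner of the box of `X`: `basePt X − r·𝟙`. [folklore] -/
def boxCorner (r : ℕ) (X : Finset (Site d L)) : Site d L := basePt X - fun _ => (r : ZMod L)

/-- The box of `X`: side `2r + 2` in every direction. [folklore] -/
def polyBox (r : ℕ) (X : Finset (Site d L)) : Site d L → Prop := Box (boxCorner r X) fun _ => 2 * r + 2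

/-- The plaquette support of the box of `X`: plaquettes with all four corners in the box. [folklore] -/
def boxSupp (r : ℕ) (X : Finset (Site d L)) : Finset (Plaquette d L) := by
  classical
  exact Finset.univ.filter fun p => polyBox r X p.1 ∧ polyBox r X (p.1.shift p.2.1.1) ∧ polyBox r X (p.1.shift p.2.1.2) ∧
    polyBox r X ((p.1.shift p.2.1.2).shift p.2.1.1)

omit [NeZero L] [NeZero N] in
/-- Coordinates of two points of a polymer differ by at most its diameter (cyclically). [folklore] -/
theorem natAbs_valMinAbs_sub_le_polymerDiam {X : Finset (Site d L)} {x y : Site d L} (hx : x ∈ X) (hy : y ∈ X) (v : Fin d) :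
    (x v - y v).valMinAbs.natAbs ≤ polymerDiam X := by
  have h1 : torusNorm (x - y) ≤ polymerDiam X :=
    le_trans (Finset.le_sup (f := fun y => torusNorm (x - y)) hy) (Finset.le_sup (f := fun x => X.sup fun y => torusNorm (x - y)) hx)
  refine le_trans ?_ h1
  exact Finset.le_sup (f := fun i => ((x - y) i).valMinAbs.natAbs) (Finset.mem_univ v)

omit [NeZero N] in
/-- `val (z + m) = z.valMinAbs + m` when `0 ≤ z.valMinAbs + m < L`. [folklore] -/
theorem val_add_natCast_eq (z : ZMod L) (m : ℕ) (h0 : 0 ≤ z.valMinAbs + m) (hL : z.valMinAbs + m < L) :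
    ((z + (m : ZMod L)).val : ℤ) = z.valMinAbs + m := by
  have e : z + (m : ZMod L) = ((z.valMinAbs + m : ℤ) : ZMod L) := by rw [Int.cast_add, Int.cast_natCast, ZMod.coe_valMinAbs]
  rw [e, ZMod.val_intCast, Int.emod_eq_of_lt h0 hL]

omit [NeZero N] in
/-- **Points of a small polymer and their unit shifts lie in its box** (`polymerDiam X ≤ r`, `2r + 2 < L`). [folklore] -/
theorem polyBox_of_mem {r : ℕ} (hL : 2 * r + 2 < L) {X : Finset (Site d L)} (hX : polymerDiam X ≤ r) {x : Site d L}
    (hx : x ∈ X) (u : Fin d) : polyBox r X x ∧ polyBox r X (x.shift u) := by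
  have hne : X.Nonempty := ⟨x, hx⟩
  have hb := basePt_mem hne
  have hco : ∀ v, (x v - basePt X v).valMinAbs.natAbs ≤ r := fun v =>
    (natAbs_valMinAbs_sub_le_polymerDiam hx hb v).trans hX
  have hzr : ∀ v, -(r : ℤ) ≤ (x v - basePt X v).valMinAbs ∧ (x v - basePt X v).valMinAbs ≤ r := fun v => by
    have h := hco v
    constructor <;> omega
  constructor
  · intro v
    show (x v - boxCorner r X v).val < 2 * r + 2
    have e : x v - boxCorner r X v = (x v - basePt X v) + (r : ZMod L) := by simp [boxCorner]; ring
    rw [e]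
    have h := val_add_natCast_eq (x v - basePt X v) r (by have := hzr v; omega) (by have := hzr v; omega)
    have := hzr v
    omega
  · intro v
    show ((x.shift u) v - boxCorner r X v).val < 2 * r + 2
    by_cases huv : u = v
    · subst huv
      have e : (x.shift u) u - boxCorner r X u = (x u - basePt X u) + ((r + 1 : ℕ) : ZMod L) := by
        simp [boxCorner, Site.shift]; ring
      rw [e]
      have h := val_add_natCast_eq (x u - basePt X u) (r + 1) (by have := hzr u; omega) (by have := hzr u; omega)
      have := hzr u
      omega
    · have e : (x.shift u) v - boxCorner r X v = (x v - basePt X v) + (r : ZMod L) := by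
        simp [boxCorner, Site.shift, Pi.single_eq_of_ne (Ne.symm huv)]; ring
      rw [e]
      have h := val_add_natCast_eq (x v - basePt X v) r (by have := hzr v; omega) (by have := hzr v; omega)
      have := hzr v
      omega

omit [NeZero N] in
/-- The links of a small polymer have both endpoints in its box. [folklore] -/
theorem polyBox_of_mem_polymerEdges {r : ℕ} (hL : 2 * r + 2 < L) {X : Finset (Site d L)} (hX : polymerDiam X ≤ r)
    {e : Edge d L} (he : e ∈ (↑(polymerEdges 1 X) : Set (Edge d L))) : polyBox r X e.1 ∧ polyBox r X (e.1.shift e.2) := by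
  have hx : e.1 ∈ X := by simpa using Finset.mem_coe.1 he
  exact polyBox_of_mem hL hX hx e.2

/-! ### The flux defect of one activity -/

variable (W : Perturbation d L N) (r : ℕ)

/-- **The twist defect of `W_X` as a function of the flux configuration on the box of `X`** (zero if `φ` is not a
curl on the box support). [folklore] -/
def fluxDefect (X : Finset (Site d L)) (φ : Plaquette d L → ZMod N) (U : GaugeConfig d L (SUN N)) : ℝ := by
  classical
  exact if h : ∃ k : Edge d L → ZMod N, ∀ p ∈ boxSupp r X, flux k p = φ p then
    W.act X (twistOf (Classical.choose h) * U) - W.act X U else 0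

omit [NeZero L] [NeZero N] in
/-- `plaqSum` is antisymmetric in the plane directions. [folklore] -/
theorem plaqSum_swap (k : Edge d L → ZMod N) (y : Site d L) (w v : Fin d) : plaqSum k y w v = -plaqSum k y v w := by
  simp only [plaqSum]; ring

/-- **Two twists with the same fluxes on the box support act alike on a small activity** (the Poincaré lemma). [folklore] -/
theorem act_twistOf_eq_of_flux_eq {r : ℕ} (hL : 2 * r + 2 < L) {W : Perturbation d L N} {X : Finset (Site d L)}
    (hX : polymerDiam X ≤ r) {k k' : Edge d L → ZMod N} (h : ∀ p ∈ boxSupp r X, flux k p = flux k' p)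
    (U : GaugeConfig d L (SUN N)) : W.act X (twistOf k * U) = W.act X (twistOf k' * U) := by
  classical
  refine apply_twistOf_mul_eq_of_plaqSum_eq (c := boxCorner r X) (n := fun _ => 2 * r + 2) (fun _ => hL)
    (W.gaugeInvariant' X) (W.dependsOn' X) (fun e he => polyBox_of_mem_polymerEdges hL hX he) (fun y w v hwv hy hyw hyv hyvw => ?_) U
  rcases lt_or_gt_of_ne hwv with hlt | hlt
  · have hp : (⟨y, ⟨(w, v), hlt⟩⟩ : Plaquette d L) ∈ boxSupp r X := by
      simp only [boxSupp, Finset.mem_filter, Finset.mem_univ, true_and]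
      exact ⟨hy, hyw, hyv, hyvw⟩
    exact h _ hp
  · have hyvw' : polyBox r X ((y.shift w).shift v) := by
      rw [show (y.shift w).shift v = (y.shift v).shift w by simp only [Site.shift]; abel]; exact hyvw
    have hp : (⟨y, ⟨(v, w), hlt⟩⟩ : Plaquette d L) ∈ boxSupp r X := by
      simp only [boxSupp, Finset.mem_filter, Finset.mem_univ, true_and]
      exact ⟨hy, hyv, hyw, hyvw'⟩
    have h' := h _ hp
    simp only [flux] at h'
    rw [plaqSum_swap k, plaqSum_swap k', h']

/-- **The defect identity for one activity**: `fluxDefect W r X (curl k) U = W_X(ζ_k U) − W_X(U)` for every twist `k`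
(range `r`, `2r + 2 < L`). [folklore] -/
theorem fluxDefect_flux {r : ℕ} (hL : 2 * r + 2 < L) {W : Perturbation d L N} (hW : HasRange r W) (X : Finset (Site d L))
    (k : Edge d L → ZMod N) (U : GaugeConfig d L (SUN N)) :
    fluxDefect W r X (flux k) U = W.act X (twistOf k * U) - W.act X U := by
  classical
  have hex : ∃ k' : Edge d L → ZMod N, ∀ p ∈ boxSupp r X, flux k' p = flux k p := ⟨k, fun _ _ => rfl⟩
  unfold fluxDefect
  rw [dif_pos hex]
  by_cases hX : polymerDiam X ≤ r
  · rw [act_twistOf_eq_of_flux_eq hL hX (Classical.choose_spec hex) U]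
  · have h0 : W.act X = 0 := hW X (not_le.1 hX)
    simp [h0]

/-- The defect reads the flux configuration only on the box support. [folklore] -/
theorem dependsOn_fluxDefect {r : ℕ} (hL : 2 * r + 2 < L) {W : Perturbation d L N} (hW : HasRange r W)
    (X : Finset (Site d L)) (U : GaugeConfig d L (SUN N)) :
    DependsOn (fun φ => fluxDefect W r X φ U) (↑(boxSupp r X) : Set (Plaquette d L)) := by
  classical
  intro φ φ' hφ
  simp only [fluxDefect]
  have hiff : (∃ k : Edge d L → ZMod N, ∀ p ∈ boxSupp r X, flux k p = φ p) ↔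
      ∃ k : Edge d L → ZMod N, ∀ p ∈ boxSupp r X, flux k p = φ' p := by
    constructor <;> rintro ⟨k, hk⟩ <;> refine ⟨k, fun p hp => ?_⟩
    · rw [hk p hp, hφ p (Finset.mem_coe.2 hp)]
    · rw [hk p hp, ← hφ p (Finset.mem_coe.2 hp)]
  by_cases h : ∃ k : Edge d L → ZMod N, ∀ p ∈ boxSupp r X, flux k p = φ p
  · have h' := hiff.1 h
    rw [dif_pos h, dif_pos h']
    by_cases hX : polymerDiam X ≤ r
    · rw [act_twistOf_eq_of_flux_eq hL hX (k := Classical.choose h) (k' := Classical.choose h') (fun p hp => by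
        rw [Classical.choose_spec h p hp, Classical.choose_spec h' p hp, hφ p (Finset.mem_coe.2 hp)]) U]
    · have h0 : W.act X = 0 := hW X (not_le.1 hX)
      simp [h0]
  · rw [dif_neg h, dif_neg (fun h' => h (hiff.2 h'))]

/-- The total oscillation bound of an activity from a load witness: `∑_{e ∈ links X} osc X e`. [folklore] -/
def oscSum {W : Perturbation d L N} (w : LoadWitness W) (X : Finset (Site d L)) : ℝ :=
  ∑ e ∈ polymerEdges 1 X, w.osc X e

omit [NeZero N] in
/-- `0 ≤ oscSum`. [folklore] -/
theorem oscSum_nonneg {W : Perturbation d L N} (w : LoadWitness W) (X : Finset (Site d L)) : 0 ≤ oscSum w X :=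
  Finset.sum_nonneg fun e _ => (w.osc_spec X).nonneg e

/-- **The defect is bounded by the total oscillation** (Friedli–Velenik (6.39) via the tree's
`Dobrushin.abs_sub_le_sum_of_dependsOn`). [folklore] -/
theorem abs_fluxDefect_le {W : Perturbation d L N} (w : LoadWitness W) (r : ℕ) (X : Finset (Site d L))
    (φ : Plaquette d L → ZMod N) (U : GaugeConfig d L (SUN N)) : |fluxDefect W r X φ U| ≤ oscSum w X := by
  classical
  unfold fluxDefect
  split_ifs with h
  · exact Literature.Probability.LatticeModels.Dobrushin.abs_sub_le_sum_of_dependsOn (W.dependsOn' X) (w.osc_spec X) _ _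
  · rw [abs_zero]; exact oscSum_nonneg w X

/-- The RANGE-CUT total oscillation: `oscSum` for polymers of diameter `≤ r`, `0` beyond (their activities vanish). [folklore] -/
def oscSumR {W : Perturbation d L N} (w : LoadWitness W) (r : ℕ) (X : Finset (Site d L)) : ℝ :=
  if polymerDiam X ≤ r then oscSum w X else 0

omit [NeZero N] in
/-- `0 ≤ oscSumR`. [folklore] -/
theorem oscSumR_nonneg {W : Perturbation d L N} (w : LoadWitness W) (r : ℕ) (X : Finset (Site d L)) : 0 ≤ oscSumR w r X := by
  unfold oscSumR; split_ifs
  · exact oscSum_nonneg w X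
  · exact le_rfl

omit [NeZero N] in
/-- `oscSumR` vanishes beyond the range. [folklore] -/
theorem oscSumR_eq_zero {W : Perturbation d L N} (w : LoadWitness W) {r : ℕ} {X : Finset (Site d L)} (h : r < polymerDiam X) :
    oscSumR w r X = 0 := by
  unfold oscSumR; rw [if_neg (not_le.2 h)]

omit [NeZero N] in
/-- `oscSumR ≤ oscSum`. [folklore] -/
theorem oscSumR_le {W : Perturbation d L N} (w : LoadWitness W) (r : ℕ) (X : Finset (Site d L)) : oscSumR w r X ≤ oscSum w X := by
  unfold oscSumR; split_ifs
  · exact le_rfl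
  · exact oscSum_nonneg w X

/-- **The defect is bounded by the range-cut total oscillation** (under `HasRange r W`). [folklore] -/
theorem abs_fluxDefect_le_oscSumR {W : Perturbation d L N} (hW : HasRange r W) (w : LoadWitness W) (X : Finset (Site d L))
    (φ : Plaquette d L → ZMod N) (U : GaugeConfig d L (SUN N)) : |fluxDefect W r X φ U| ≤ oscSumR w r X := by
  classical
  unfold oscSumR
  split_ifs with hX
  · exact abs_fluxDefect_le w r X φ U
  · have h0 : W.act X = 0 := hW X (not_le.1 hX)
    unfold fluxDefect
    split_ifs <;> simp [h0]

/-- **THE DEFECT IDENTITY**: `W(ζ_k U) = W(U) + ∑_X fluxDefect W r X (curl k) U` for every twist `k`. [folklore] -/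
theorem total_twist_eq_fluxDefect {r : ℕ} (hL : 2 * r + 2 < L) {W : Perturbation d L N} (hW : HasRange r W)
    (k : Edge d L → ZMod N) (U : GaugeConfig d L (SUN N)) :
    W.total (twistOf k * U) = W.total U + ∑ X : Finset (Site d L), fluxDefect W r X (flux k) U := by
  classical
  have huniv : polymers (d := d) (L := L) 1 = Finset.univ := Finset.eq_univ_of_forall mem_polymers_one
  simp only [QuasiLocalGaugePerturbation.total, huniv, fluxDefect_flux hL hW, Finset.sum_sub_distrib]
  ring

/-! ### Geometry of the box supports: window `2r + 2`, extent `2r + 1` -/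

omit [NeZero N] in
/-- The `i`-links of a box support lie in the box. [folklore] -/
theorem polyBox_of_mem_iLinks {r : ℕ} {X : Finset (Site d L)} (i : Fin d) {y : Site d L} (hy : y ∈ iLinks i (boxSupp r X)) :
    polyBox r X y := by
  classical
  obtain ⟨p, hp, hyp, -⟩ := apply_eq_of_mem_iLinks i hy
  simp only [boxSupp, Finset.mem_filter, Finset.mem_univ, true_and] at hp
  obtain ⟨z, ⟨⟨a, b⟩, hab⟩⟩ := p
  simp only [iSites] at hyp
  split_ifs at hyp with h1 h2
  · simp only [Finset.mem_insert, Finset.mem_singleton] at hyp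
    rcases hyp with rfl | rfl
    · exact hp.1
    · exact hp.2.2.1
  · simp only [Finset.mem_insert, Finset.mem_singleton] at hyp
    rcases hyp with rfl | rfl
    · exact hp.2.1
    · exact hp.1
  · simp at hyp

omit [NeZero N] in
/-- Two points of one box are at cyclic coordinate distance `≤ 2r + 1`. [folklore] -/
theorem natAbs_valMinAbs_sub_le_of_polyBox {r : ℕ} {X : Finset (Site d L)} {y y' : Site d L} (hy : polyBox r X y)
    (hy' : polyBox r X y') (v : Fin d) : (y v - y' v).valMinAbs.natAbs ≤ 2 * r + 1 := by
  have e : y v - y' v = (((y v - boxCorner r X v).val : ℕ) : ZMod L) - (((y' v - boxCorner r X v).val : ℕ) : ZMod L) := by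
    rw [ZMod.natCast_zmod_val, ZMod.natCast_zmod_val]; ring
  rw [e]
  refine (natAbs_valMinAbs_natCast_sub_le _ _).trans (max_le ?_ ?_)
  · have h1 : (y v - boxCorner r X v).val < 2 * r + 2 := hy v
    omega
  · have h1 : (y' v - boxCorner r X v).val < 2 * r + 2 := hy' v
    omega

/-! ### The member theorem -/

/-- **EVERY RANGE-`r` MEMBER IS IN THE WINDOWED CENTRE TUBE, given a defect-row bound**: `HasRange r W`, a load witness `w`,
`2r + 2 < L`, and `∑_{X : y ∈ iLinks i (boxSupp r X)} oscSumR w r X · (|iLinks i (boxSupp r X)| − 1) ≤ b` for every direction `i` and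
`i`-link `y` ⇒ `IsFluxLocalW (2r + 2) (2r + 1) b W`.  (Bounding `b` by the oscillation load `ε₀` is the counting step (P4).)
[folklore] -/
theorem isFluxLocalW_of_hasRange {r : ℕ} (hL : 2 * r + 2 < L) {W : Perturbation d L N} (hW : HasRange r W) (w : LoadWitness W)
    {b : ℝ} (hrow : ∀ (i : Fin d) (y : Site d L),
      ∑ X ∈ (Finset.univ : Finset (Finset (Site d L))).filter (fun X => y ∈ iLinks i (boxSupp r X)),
        oscSumR w r X * (((iLinks i (boxSupp r X)).card : ℝ) - 1) ≤ b) :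
    IsFluxLocalW (2 * r + 2) (2 * r + 1) b W :=
  isFluxLocalW_of_family (ι := Finset (Site d L)) W.total (boxSupp r) (fluxDefect W r) (oscSumR w r)
    (fun X U => dependsOn_fluxDefect hL hW X U) (oscSumR_nonneg w r) (fun X φ U => abs_fluxDefect_le_oscSumR (r := r) hW w X φ U)
    (fun _ i _ hy _ hy' => Nat.lt_succ_of_le
      (natAbs_valMinAbs_sub_le_of_polyBox (polyBox_of_mem_iLinks i hy) (polyBox_of_mem_iLinks i hy') i))
    (fun _ i j _ hy _ hy' => natAbs_valMinAbs_sub_le_of_polyBox (polyBox_of_mem_iLinks i hy) (polyBox_of_mem_iLinks i hy') j)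
    hrow (fun k U => total_twist_eq_fluxDefect hL hW k U)

/-- **THE RANGE-`r` TIER-1 BALL AROUND ANY CENTRE-BLIND ACTION, windowed centre-tube bound** (`N ≥ 2`, `2r + 2 < L`): for
`W_b` twist-blind of ANY size and `W` of range `r` with a load witness whose defect rows are `≤ b`, at `c = 2(d−1)N|β| + b ≤ 1`:
`|⟨W_{R×T}⟩_{β, W_b + W, L}| ≤ (4 c^{⌈T/(2r+1)⌉})^{#{ρ<R : (2r+2)∣ρ}}`.  No Lipschitz load, any `N`-ality. [folklore] -/
theorem areaLaw_of_hasRange_add_twistBlind (hN : 2 ≤ N) {r : ℕ} (hL : 2 * r + 2 < L) {β b c : ℝ} {Wb W : Perturbation d L N}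
    (hb : IsTwistBlind Wb) (hW : HasRange r W) (w : LoadWitness W)
    (hrow : ∀ (i : Fin d) (y : Site d L),
      ∑ X ∈ (Finset.univ : Finset (Finset (Site d L))).filter (fun X => y ∈ iLinks i (boxSupp r X)),
        oscSumR w r X * (((iLinks i (boxSupp r X)).card : ℝ) - 1) ≤ b)
    (hc : 2 * ((d - 1 : ℕ) : ℝ) * |β| * N + b ≤ c) (hc1 : c ≤ 1) (x : Site d L) {i j : Fin d} (hij : i ≠ j) {R T : ℕ}
    (hR : 2 * R ≤ L) (hT : 2 * T ≤ L) :
    |(Wb + W).expectation (fundamentalRep (Fin N)) β (wilsonLoop (fundamentalRep (Fin N)) x i j R T)| ≤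
      (4 * c ^ ((T + (2 * r + 1) - 1) / (2 * r + 1))) ^ (selIdx (2 * r + 2) R).card :=
  abs_wilsonLoop_le_of_isFluxLocalW hN (by omega) (by omega) hc hc1 _
    (IsFluxLocalW.twistBlind_add hb (isFluxLocalW_of_hasRange hL hW w hrow)) x hij hR hT

end Summit.Ventures.YMGap.RobustBall

end
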